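import Literature.Analysis.FluidPDE.LocalLerayWeakStrongProofs
import Literature.Analysis.FluidPDE.SuitableWeakPressure
import Literature.Analysis.FluidPDE.DistributionalToWeak
import Literature.Analysis.FluidPDE.CKNTenThirdsInterpolation
import Literature.Analysis.FluidPDE.CKN1982Setting
import HarnessLib

/-!
# Tools for the stability of singular points of local Leray solutions at the final time

Analysis/FluidPDE proof file (no new definitions, no named facts), first half of the reduction of
the named fact `Literature.Analysis.FluidPDE.lemarieRieusset_singular_point_stability`
(`NSSereginMildFacts.lean`; Lemarié-Rieusset, *The Navier–Stokes Problem in the 21st Century*,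
proof of Thm. 15.5, PDF pp. 571–573 of the held scan) to the named facts
`lemarieRieusset_epsilon_regularity` (Thm. 14.4), `seregin_sverak_pressure_decay` and
`kangMiuraTsai_local_pressure_bound` (assembly in `NSSereginMildStability.lean`). Proved here:

* `timeGauge_slab_Ioo` — a gauge `c ∈ L^{3/2}(0, T)` lifted to `(t, x) ↦ c t` is locally
  integrable and locally `L^{3/2}` on the open slab `(0, T) × ℝ³` (the hypotheses of the
  pressure-gauge lemma `IsSuitableWeakSolutionOn.sub_pressure`);
* `IsLocalLeraySolutionOn.lintegral_ball_datum_le`, `IsLocalLeraySolutionOn.isWeaklyDivFree_datum`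
  — the datum of a slab local Leray solution inherits the uniformly local `L²` bound of the
  solution (up to a factor `2`) and is weakly divergence free (Jia–Šverák's standing hypotheses
  on the datum, consumed by `kangMiuraTsai_local_pressure_bound`, follow from the solution
  clauses: `L²_loc` attainment of the datum, divergence-free slices);
* `exists_of_ae_Ioo_of_eventually_nhdsGT` — "good times near `0`": a property holding for a.e.
  `t ∈ (0, T)` and one holding for all small `t > 0` hold simultaneously at some time.

(The `L³` convergence on cylinders and Thm. 14.4 at the final time are in
`NSSereginMildStabilityOneScale.lean`.)

## References

* P. G. Lemarié-Rieusset, *The Navier–Stokes Problem in the 21st Century*, CRC Press (2016;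
  held scan = 2nd ed.), proof of Thm. 15.5, PDF pp. 570–573.
* H. Jia, V. Šverák, Invent. Math. 196 (2014), §3, Def. 1 (standing hypotheses on the datum).
* L. Caffarelli, R. Kohn, L. Nirenberg, CPAM 35 (1982), §2, (2.9)–(2.10) (`L^{10/3}`).
-/

noncomputable section

open MeasureTheory TopologicalSpace Set Function Filter Metric Module
open _root_.Topology
open scoped ENNReal NNReal RealInnerProductSpace

namespace Literature.Analysis.FluidPDE

/-! ### The time gauge on a finite slab -/

/-- A compact subset of the open slab `(0, T) × ℝ³` lies in a box `(0, T) × B̄(0, ρ)`. [folklore] -/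
theorem exists_closedBall_of_isCompact_subset_slab_Ioo {T : ℝ}
    {K : Set (ℝ × EuclideanSpace ℝ (Fin 3))} (hK : IsCompact K)
    (hKs : K ⊆ Ioo (0 : ℝ) T ×ˢ (univ : Set (EuclideanSpace ℝ (Fin 3)))) :
    ∃ ρ : ℝ, K ⊆ Ioo (0 : ℝ) T ×ˢ closedBall (0 : EuclideanSpace ℝ (Fin 3)) ρ := by
  obtain ⟨ρ, hρ⟩ := (hK.image continuous_snd).isBounded.subset_closedBall
    (0 : EuclideanSpace ℝ (Fin 3))
  exact ⟨ρ, fun z hz => ⟨(hKs hz).1, hρ ⟨z, hz, rfl⟩⟩⟩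

/-- **The time gauge on the finite slab.** If `c ∈ L^{3/2}(0, T)`, then `(t, x) ↦ c(t)` is
locally integrable and locally `L^{3/2}` on the open slab `(0, T) × ℝ³` — the hypotheses of the
gauge lemma `IsSuitableWeakSolutionOn.sub_pressure` (on a box `(0, T) × B̄(0, ρ)` the lifted
function is in `L^{3/2}`, `MemLp.comp_fst`, and every compact subset of the slab lies in such a
box). [folklore] -/
theorem timeGauge_slab_Ioo {c : ℝ → ℝ} {T : ℝ}
    (hc : MemLp c (3 / 2 : ℝ≥0∞) (volume.restrict (Ioo 0 T))) :
    LocallyIntegrableOn (fun z : ℝ × EuclideanSpace ℝ (Fin 3) => c z.1)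
        (Ioo (0 : ℝ) T ×ˢ (univ : Set (EuclideanSpace ℝ (Fin 3)))) volume ∧
      ∀ K ⊆ Ioo (0 : ℝ) T ×ˢ (univ : Set (EuclideanSpace ℝ (Fin 3))), IsCompact K →
        ∫⁻ z in K, ‖c z.1‖ₑ ^ (3 / 2 : ℝ) < ∞ := by
  -- the lifted function on boxes
  have hbox : ∀ ρ : ℝ, MemLp (fun z : ℝ × EuclideanSpace ℝ (Fin 3) => c z.1) (3 / 2 : ℝ≥0∞)
      (volume.restrict (Ioo (0 : ℝ) T ×ˢ closedBall (0 : EuclideanSpace ℝ (Fin 3)) ρ)) := by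
    intro ρ
    haveI : IsFiniteMeasure (volume.restrict (closedBall (0 : EuclideanSpace ℝ (Fin 3)) ρ)) :=
      ⟨by rw [Measure.restrict_apply_univ]; exact measure_closedBall_lt_top⟩
    have h := hc.comp_fst (volume.restrict (closedBall (0 : EuclideanSpace ℝ (Fin 3)) ρ))
    rwa [Measure.prod_restrict, ← Measure.volume_eq_prod] at h
  have hvol : ∀ ρ : ℝ,
      volume (Ioo (0 : ℝ) T ×ˢ closedBall (0 : EuclideanSpace ℝ (Fin 3)) ρ) < ∞ := by
    intro ρ
    rw [Measure.volume_eq_prod, Measure.prod_prod]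
    exact ENNReal.mul_lt_top (by simp)
      (measure_closedBall_lt_top (x := (0 : EuclideanSpace ℝ (Fin 3))))
  have h32 : (3 / 2 : ℝ≥0∞).toReal = 3 / 2 := by
    rw [ENNReal.toReal_div]
    norm_num
  have hne0 : (3 / 2 : ℝ≥0∞) ≠ 0 := (ENNReal.div_pos_iff.2 ⟨by norm_num, by norm_num⟩).ne'
  have hnetop : (3 / 2 : ℝ≥0∞) ≠ ∞ := ENNReal.div_ne_top (by norm_num) (by norm_num)
  have h1le : (1 : ℝ≥0∞) ≤ 3 / 2 := by
    rw [ENNReal.le_div_iff_mul_le (Or.inl (by norm_num)) (Or.inl (by norm_num))]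
    norm_num
  refine ⟨(locallyIntegrableOn_iff (isOpen_Ioo.prod isOpen_univ).isLocallyClosed).2
    fun K hKs hKc => ?_, fun K hKs hKc => ?_⟩
  · obtain ⟨ρ, hsub⟩ := exists_closedBall_of_isCompact_subset_slab_Ioo hKc hKs
    haveI : IsFiniteMeasure
        (volume.restrict (Ioo (0 : ℝ) T ×ˢ closedBall (0 : EuclideanSpace ℝ (Fin 3)) ρ)) :=
      isFiniteMeasure_restrict.2 (hvol ρ).ne
    have hI : IntegrableOn (fun z : ℝ × EuclideanSpace ℝ (Fin 3) => c z.1)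
        (Ioo (0 : ℝ) T ×ˢ closedBall (0 : EuclideanSpace ℝ (Fin 3)) ρ) volume :=
      ((hbox ρ).mono_exponent h1le).integrable le_rfl
    exact hI.mono_set hsub
  · obtain ⟨ρ, hsub⟩ := exists_closedBall_of_isCompact_subset_slab_Ioo hKc hKs
    have hfin := lintegral_rpow_enorm_lt_top_of_eLpNorm_lt_top hne0 hnetop (hbox ρ).eLpNorm_lt_top
    rw [h32] at hfin
    exact lt_of_le_of_lt (lintegral_mono_set hsub) hfin

/-- **Gauging the pressure of a suitable weak solution on a finite slab**: if `(u, p)` is a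
suitable weak solution on `(0, T) × ℝ³` and `c ∈ L^{3/2}(0, T)`, then `(u, p - c(t))` is a
suitable weak solution on the slab (Caffarelli–Kohn–Nirenberg 1982, §2: the pressure is
determined up to a function of time; `IsSuitableWeakSolutionOn.sub_pressure` with
`timeGauge_slab_Ioo`). [cite: CaffarelliKohnNirenberg1982, §2] -/
theorem IsSuitableWeakSolutionOn.sub_timeGauge_slab {T ν : ℝ}
    {u : ℝ → EuclideanSpace ℝ (Fin 3) → EuclideanSpace ℝ (Fin 3)}
    {p : ℝ → EuclideanSpace ℝ (Fin 3) → ℝ}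
    (h : IsSuitableWeakSolutionOn (slab (EuclideanSpace ℝ (Fin 3)) (Ioo 0 T) isOpen_Ioo) ν 0 u p)
    {c : ℝ → ℝ} (hc : MemLp c (3 / 2 : ℝ≥0∞) (volume.restrict (Ioo 0 T))) :
    IsSuitableWeakSolutionOn (slab (EuclideanSpace ℝ (Fin 3)) (Ioo 0 T) isOpen_Ioo) ν 0 u
      (fun t x => p t x - c t) := by
  obtain ⟨hci, hcf⟩ := timeGauge_slab_Ioo hc
  exact h.sub_pressure hci hcf

/-! ### The datum of a slab local Leray solution -/

/-- `‖a‖ₑ² ≤ 2 (‖b‖ₑ² + ‖b - a‖ₑ²)` (triangle inequality and `(x + y)² ≤ 2 (x² + y²)`).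
[folklore] -/
theorem enorm_sq_le_two_mul_sq_add_sq_sub {F : Type*} [NormedAddCommGroup F] (a b : F) :
    ‖a‖ₑ ^ 2 ≤ 2 * (‖b‖ₑ ^ 2 + ‖b - a‖ₑ ^ 2) := by
  have h1 : ‖a‖ₑ ≤ ‖b‖ₑ + ‖b - a‖ₑ := by
    calc ‖a‖ₑ = ‖b - (b - a)‖ₑ := by congr 1; abel
      _ ≤ ‖b‖ₑ + ‖b - a‖ₑ := enorm_sub_le
  have h2 := ENNReal.rpow_add_le_mul_rpow_add_rpow ‖b‖ₑ ‖b - a‖ₑ (by norm_num : (1 : ℝ) ≤ 2)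
  have e2 : ∀ x : ℝ≥0∞, x ^ (2 : ℝ) = x ^ (2 : ℕ) := fun x => by
    rw [show (2 : ℝ) = ((2 : ℕ) : ℝ) by norm_num, ENNReal.rpow_natCast]
  have e1 : (2 : ℝ≥0∞) ^ ((2 : ℝ) - 1) = 2 := by
    rw [show (2 : ℝ) - 1 = ((1 : ℕ) : ℝ) by norm_num, ENNReal.rpow_natCast, pow_one]
  rw [e2, e2, e2, e1] at h2
  calc ‖a‖ₑ ^ 2 ≤ (‖b‖ₑ + ‖b - a‖ₑ) ^ 2 := by gcongr
    _ ≤ 2 * (‖b‖ₑ ^ 2 + ‖b - a‖ₑ ^ 2) := h2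

/-- **Good times near `t = 0`.** If a property holds for a.e. `t ∈ (0, T)` (`T > 0`) and another
holds for all `t > 0` close to `0`, some time enjoys both (the first set has full measure in
`(0, min T δ)`, which has positive measure). [folklore] -/
theorem exists_of_ae_Ioo_of_eventually_nhdsGT {T : ℝ} (hT : 0 < T) {P Q : ℝ → Prop}
    (hP : ∀ᵐ t ∂(volume.restrict (Ioo 0 T)), P t) (hQ : ∀ᶠ t in 𝓝[>] (0 : ℝ), Q t) :
    ∃ t, 0 < t ∧ P t ∧ Q t := by
  obtain ⟨δ, hδ, hδQ⟩ := (mem_nhdsGT_iff_exists_Ioo_subset).1 hQ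
  have hfreq : ∃ᵐ t ∂(volume.restrict (Ioo 0 T)), t ∈ Ioo 0 δ := by
    rw [frequently_ae_iff]
    intro h0
    simp only [setOf_mem_eq] at h0
    have h1 : volume.restrict (Ioo 0 T) (Ioo 0 δ) = volume (Ioo 0 δ ∩ Ioo 0 T) :=
      Measure.restrict_apply measurableSet_Ioo
    have h2 : Ioo 0 δ ∩ Ioo 0 T = Ioo 0 (min δ T) := Ioo_inter_Ioo.trans (by rw [max_self])
    rw [h1, h2, Real.volume_Ioo, ENNReal.ofReal_eq_zero] at h0
    have : (0 : ℝ) < min δ T := lt_min hδ hT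
    linarith
  have hP' : ∀ᵐ t ∂(volume.restrict (Ioo 0 T)), t ∈ Ioo 0 T ∧ P t := by
    filter_upwards [ae_restrict_mem measurableSet_Ioo, hP] with t h1 h2
    exact ⟨h1, h2⟩
  obtain ⟨t, ⟨htI, hPt⟩, htδ⟩ := (hP'.and_frequently hfreq).exists
  exact ⟨t, htI.1, hPt, hδQ htδ⟩

variable {T ν : ℝ} {v₀ : EuclideanSpace ℝ (Fin 3) → EuclideanSpace ℝ (Fin 3)}
  {v : ℝ → EuclideanSpace ℝ (Fin 3) → EuclideanSpace ℝ (Fin 3)}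
  {π : ℝ → EuclideanSpace ℝ (Fin 3) → ℝ}

/-- **The datum inherits the uniformly local `L²` bound** (up to a factor `2`): if
`∫_{B₁(x₀)} |v(t)|² ≤ C` for a.e. `t ∈ (0, T)` and all `x₀`, then `∫_{B₁(x₀)} |v₀|² ≤ 2C` for all
`x₀` — test the `L²_loc` attainment of the datum on `B̄₁(x₀)` at good times `t ↓ 0`:
`|v₀|² ≤ 2(|v(t)|² + |v(t) - v₀|²)`. (With Minkowski instead of this crude splitting the factor
`2` disappears; the crude form avoids any measurability of `v₀`.) [folklore] -/
theorem IsLocalLeraySolutionOn.lintegral_ball_datum_le (h : IsLocalLeraySolutionOn T ν v₀ v π)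
    (hT : 0 < T) {C : ℝ≥0∞}
    (hC : ∀ᵐ t ∂(volume.restrict (Ioo 0 T)), ∀ x₀ : EuclideanSpace ℝ (Fin 3),
      ∫⁻ x in ball x₀ 1, ‖v t x‖ₑ ^ 2 ≤ C)
    (x₀ : EuclideanSpace ℝ (Fin 3)) :
    ∫⁻ x in ball x₀ 1, ‖v₀ x‖ₑ ^ 2 ≤ 2 * C := by
  rcases eq_or_ne C ∞ with rfl | hCtop
  · simp
  refine ENNReal.le_of_forall_pos_le_add fun ε hε _ => ?_
  -- good times: the bound, measurability of the slice, smallness of the `L²_loc` error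
  have hε2 : (0 : ℝ≥0∞) < (ε : ℝ≥0∞) / 2 := ENNReal.half_pos (by exact_mod_cast hε.ne')
  have hev : ∀ᶠ t in 𝓝[>] (0 : ℝ), ∫⁻ x in closedBall x₀ 1, ‖v t x - v₀ x‖ₑ ^ 2 < ε / 2 :=
    (h.initial (closedBall x₀ 1) (isCompact_closedBall _ _)).eventually (Iio_mem_nhds hε2)
  obtain ⟨t, -, ⟨hbt, hmt⟩, hsmall⟩ := exists_of_ae_Ioo_of_eventually_nhdsGT hT
    (hC.and h.ae_aestronglyMeasurable_slice) hev
  have hmeas1 : AEMeasurable (fun x => ‖v t x‖ₑ ^ 2) (volume.restrict (ball x₀ 1)) :=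
    (hmt.aemeasurable.enorm.pow_const 2).restrict
  have hmeas : AEMeasurable (fun x => 2 * ‖v t x‖ₑ ^ 2) (volume.restrict (ball x₀ 1)) :=
    hmeas1.const_mul 2
  calc ∫⁻ x in ball x₀ 1, ‖v₀ x‖ₑ ^ 2
      ≤ ∫⁻ x in ball x₀ 1, (2 * ‖v t x‖ₑ ^ 2 + 2 * ‖v t x - v₀ x‖ₑ ^ 2) := by
        refine lintegral_mono fun x => ?_
        rw [← mul_add]
        exact enorm_sq_le_two_mul_sq_add_sq_sub (v₀ x) (v t x)
    _ = (2 * ∫⁻ x in ball x₀ 1, ‖v t x‖ₑ ^ 2) + 2 * ∫⁻ x in ball x₀ 1, ‖v t x - v₀ x‖ₑ ^ 2 := by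
        rw [lintegral_add_left' hmeas, lintegral_const_mul'' _ hmeas1,
          lintegral_const_mul' _ _ ENNReal.ofNat_ne_top]
    _ ≤ 2 * C + 2 * (ε / 2) := by
        have h1 : ∫⁻ x in ball x₀ 1, ‖v t x - v₀ x‖ₑ ^ 2 ≤ ε / 2 :=
          (lintegral_mono_set ball_subset_closedBall).trans hsmall.le
        have h2 := hbt x₀
        gcongr
    _ = 2 * C + ε := by rw [ENNReal.mul_div_cancel two_ne_zero ENNReal.ofNat_ne_top]

/-! ### Divergence-free slices and the weak divergence-freeness of the datum -/

/-- **A.e. slice of a slab local Leray solution is weakly orthogonal to a fixed gradient.** For a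
test function `θ` on `ℝ³`, `∫ ⟪v(t), ∇θ⟫ = 0` for a.e. `t ∈ (0, T)`: test the space–time
divergence identity with `η_k(t) θ(x)`, `η_k` smooth bumps whose supports `(T/2 - r_k, T/2 + r_k)`
exhaust `(0, T)` (`ae_integral_inner_gradient_eq_zero` of `SuitableWeakPressure.lean` for each
`k`, then a countable intersection). [folklore] -/
theorem IsLocalLeraySolutionOn.ae_integral_inner_gradient_slice_eq_zero
    (h : IsLocalLeraySolutionOn T ν v₀ v π) (hT : 0 < T)
    {θ : EuclideanSpace ℝ (Fin 3) → ℝ}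
    (hθ : FunctionSpaces.IsTestFunctionOn (⊤ : Opens (EuclideanSpace ℝ (Fin 3))) θ) :
    ∀ᵐ t ∂(volume.restrict (Ioo 0 T)), ∫ x, ⟪v t x, gradient θ x⟫ = 0 := by
  obtain ⟨hu, -, -, hdiv, -⟩ := h.distributional
  have hθd : Differentiable ℝ θ := hθ.contDiff.differentiable (by simp)
  -- the radii `r k = T/2 · (k+1)/(k+2) ↑ T/2` and the bumps `η_k` at `T/2`
  set r : ℕ → ℝ := fun k => T / 2 * (((k : ℝ) + 1) / ((k : ℝ) + 2)) with hr
  have hr_pos : ∀ k, 0 < r k := fun k => by positivity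
  have hr_lt : ∀ k, r k < T / 2 := fun k => by
    have h1 : ((k : ℝ) + 1) / ((k : ℝ) + 2) < 1 := by
      rw [div_lt_one (by positivity)]; linarith
    calc r k = T / 2 * (((k : ℝ) + 1) / ((k : ℝ) + 2)) := rfl
      _ < T / 2 * 1 := by gcongr
      _ = T / 2 := mul_one _
  have hgood : ∀ k : ℕ, ∀ᵐ t : ℝ, t ∈ ball (T / 2) (r k) → ∫ x, ⟪v t x, gradient θ x⟫ = 0 := by
    intro k
    let η : ContDiffBump (T / 2 : ℝ) := ⟨r k / 2, r k, by positivity, by linarith [hr_pos k]⟩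
    have hηc : ContDiff ℝ (⊤ : ℕ∞) η := η.contDiff
    have hηs : HasCompactSupport η := η.hasCompactSupport
    have hηI : tsupport η ⊆ Ioo 0 T := by
      rw [η.tsupport_eq]
      intro t ht
      rw [mem_closedBall, Real.dist_eq] at ht
      have h1 := hr_lt k
      constructor <;> [linarith [(abs_sub_lt_iff.1 (ht.trans_lt h1)).2];
        linarith [(abs_sub_lt_iff.1 (ht.trans_lt h1)).1]]
    have hΘ : IsSpaceTimeTestOn (slab (EuclideanSpace ℝ (Fin 3)) (Ioo 0 T) isOpen_Ioo)
        (fun s x => η s • θ x) := isSpaceTimeTestOn_slab_smul isOpen_Ioo hηc hηs hηI hθ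
    have h0 := ae_integral_inner_gradient_eq_zero hu hdiv hΘ
    have hgrad : ∀ s x, gradient (fun x => η s • θ x) x = η s • gradient θ x := by
      intro s x
      rw [gradient, gradient, show (fun x => η s • θ x) = fun x => η s * θ x from rfl,
        fderiv_const_mul (hθd x), map_smul]
    filter_upwards [h0] with t ht htball
    simp_rw [hgrad, real_inner_smul_right, integral_const_mul] at ht
    exact (mul_eq_zero.1 ht).resolve_left (η.pos_of_mem_ball htball).ne'
  rw [← ae_all_iff] at hgood
  rw [ae_restrict_iff' measurableSet_Ioo]
  filter_upwards [hgood] with t ht htI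
  -- a bump covering `t`
  have hgap : 0 < T / 2 - |t - T / 2| := by
    have h' : |t - T / 2| < T / 2 := abs_sub_lt_iff.2 ⟨by linarith [htI.2], by linarith [htI.1]⟩
    linarith
  obtain ⟨k, hk⟩ := exists_nat_gt (T / (2 * (T / 2 - |t - T / 2|)))
  refine ht k ?_
  rw [mem_ball, Real.dist_eq]
  have h1 : T / 2 - r k = T / (2 * ((k : ℝ) + 2)) := by
    rw [hr]; field_simp; ring
  have h2 : T / (2 * ((k : ℝ) + 2)) < T / 2 - |t - T / 2| := by
    rw [div_lt_iff₀ (by positivity)]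
    have h3 := (div_lt_iff₀ (by positivity)).1 hk
    nlinarith
  linarith

/-- `x y ≤ c x² + c⁻¹ y²` in `ℝ≥0∞` for `0 < c < ∞` (if `y ≤ c x` the product is at most `c x²`,
otherwise `x ≤ c⁻¹ y`). [folklore] -/
theorem ENNReal.mul_le_mul_sq_add_inv_mul_sq {x y c : ℝ≥0∞} (hc : c ≠ 0) (hc' : c ≠ ∞) :
    x * y ≤ c * x ^ 2 + c⁻¹ * y ^ 2 := by
  rcases le_or_gt y (c * x) with hle | hlt
  · calc x * y ≤ x * (c * x) := by gcongr
      _ = c * x ^ 2 := by ring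
      _ ≤ c * x ^ 2 + c⁻¹ * y ^ 2 := le_self_add
  · have hx : x ≤ c⁻¹ * y := by
      calc x = c⁻¹ * (c * x) := by rw [← mul_assoc, ENNReal.inv_mul_cancel hc hc', one_mul]
        _ ≤ c⁻¹ * y := by gcongr
    calc x * y ≤ c⁻¹ * y * y := by gcongr
      _ = c⁻¹ * y ^ 2 := by ring
      _ ≤ c * x ^ 2 + c⁻¹ * y ^ 2 := le_add_self

/-- **The datum of a slab local Leray solution is weakly divergence free** (`T > 0`). For a test
function `θ`: either `⟪v₀, ∇θ⟫` is not integrable (then the pairing is `0` by convention), or,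
at good times `t ↓ 0` (divergence-free slice `∫ ⟪v(t), ∇θ⟫ = 0`, `v(t) ∈ L²_loc` measurable,
`∫_K |v(t) - v₀|² → 0` on `K = supp θ`),
`|∫ ⟪v₀, ∇θ⟫| = |∫ ⟪v₀ - v(t), ∇θ⟫| ≤ c ∫_K |v(t) - v₀|² + c⁻¹ ∫ |∇θ|²` for every `c > 0`,
which is made arbitrarily small (Jia–Šverák 2014, Def. 1: "`div u₀ = 0`" is a standing hypothesis
there; for the tree's class it follows from the solution clauses). [folklore] -/
theorem IsLocalLeraySolutionOn.isWeaklyDivFree_datum (h : IsLocalLeraySolutionOn T ν v₀ v π)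
    (hT : 0 < T) : IsWeaklyDivFree v₀ := by
  intro θ hθ
  set g : EuclideanSpace ℝ (Fin 3) → EuclideanSpace ℝ (Fin 3) := gradient θ with hg
  set f₀ : EuclideanSpace ℝ (Fin 3) → ℝ := fun x => ⟪v₀ x, g x⟫ with hf₀
  by_cases hint : Integrable f₀ volume
  swap
  · exact integral_undef hint
  -- the test field data
  set K : Set (EuclideanSpace ℝ (Fin 3)) := tsupport θ with hKdef
  have hKc : IsCompact K := hθ.hasCompactSupport
  have hKm : MeasurableSet K := (isClosed_tsupport θ).measurableSet
  have hgc : Continuous g := continuous_gradient_of_contDiff (contDiff_infty.1 hθ.contDiff 1)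
  have hg0 : ∀ x, x ∉ K → g x = 0 := fun x hx => gradient_eq_zero_of_notMem_tsupport hx
  have hgK : HasCompactSupport g := HasCompactSupport.intro hKc hg0
  obtain ⟨R, hKR⟩ := hKc.isBounded.subset_ball (0 : EuclideanSpace ℝ (Fin 3))
  have hRpos : 0 < max R 1 := lt_max_of_lt_right one_pos
  have hKR' : K ⊆ ball (0 : EuclideanSpace ℝ (Fin 3)) (max R 1) :=
    hKR.trans (ball_subset_ball (le_max_left _ _))
  obtain ⟨Mg, hMg⟩ := hgc.bounded_above_of_compact_support hgK
  have hMg0 : 0 ≤ Mg := (norm_nonneg _).trans (hMg 0)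
  -- `N = ∫ |∇θ|² < ∞`
  set N : ℝ≥0∞ := ∫⁻ x, ‖g x‖ₑ ^ 2 with hN
  have hNtop : N ≠ ∞ := by
    have h2 : MemLp g 2 volume := hgc.memLp_of_hasCompactSupport hgK
    have := lintegral_rpow_enorm_lt_top_of_eLpNorm_lt_top two_ne_zero ENNReal.ofNat_ne_top
      h2.eLpNorm_lt_top
    simpa [ENNReal.toReal_ofNat] using this.ne
  -- it suffices to show `‖∫ f₀‖ ≤ δ` for every `δ > 0`
  suffices hδ : ∀ δ : ℝ, 0 < δ → ‖∫ x, f₀ x‖ ≤ δ by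
    exact norm_le_zero_iff.1 (le_of_forall_pos_le_add fun δ hδ' => by
      rw [zero_add]; exact hδ δ hδ')
  intro δ hδ
  -- the constant `c` with `c⁻¹ N ≤ δ/2`
  have hδ2 : (0 : ℝ≥0∞) < ENNReal.ofReal (δ / 2) := ENNReal.ofReal_pos.2 (by linarith)
  have hlim : Tendsto (fun n : ℕ => ((n : ℝ≥0∞))⁻¹ * N) atTop (𝓝 0) := by
    have := ENNReal.Tendsto.mul_const ENNReal.tendsto_inv_nat_nhds_zero (Or.inr hNtop)
    rwa [zero_mul] at this
  obtain ⟨n, hn⟩ := (hlim.eventually (ge_mem_nhds hδ2)).exists_forall_of_atTop.imp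
    fun n hn => hn n le_rfl
  set c : ℝ≥0∞ := (n : ℝ≥0∞) + 1 with hcdef
  have hc0 : c ≠ 0 := ne_of_gt (lt_of_lt_of_le zero_lt_one (by rw [hcdef]; exact le_add_self))
  have hctop : c ≠ ∞ := ENNReal.add_ne_top.2 ⟨ENNReal.natCast_ne_top n, ENNReal.one_ne_top⟩
  have hcN : c⁻¹ * N ≤ ENNReal.ofReal (δ / 2) := by
    refine le_trans ?_ hn
    gcongr
    exact le_self_add
  -- good times
  obtain ⟨C, hC⟩ := h.uniformLocalEnergy (max R 1) hRpos
  have hε' : (0 : ℝ≥0∞) < ENNReal.ofReal (δ / 2) / c := ENNReal.div_pos hδ2.ne' hctop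
  have hev : ∀ᶠ t in 𝓝[>] (0 : ℝ), ∫⁻ x in K, ‖v t x - v₀ x‖ₑ ^ 2 < ENNReal.ofReal (δ / 2) / c :=
    (h.initial K hKc).eventually (Iio_mem_nhds hε')
  obtain ⟨t, -, ⟨⟨hCt, hmt⟩, hdt⟩, hsmall⟩ := exists_of_ae_Ioo_of_eventually_nhdsGT hT
    ((hC.and h.ae_aestronglyMeasurable_slice).and
      (h.ae_integral_inner_gradient_slice_eq_zero hT hθ)) hev
  -- `f_t = ⟪v(t), ∇θ⟫` is integrable with integral `0`
  set ft : EuclideanSpace ℝ (Fin 3) → ℝ := fun x => ⟪v t x, g x⟫ with hft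
  have hvt2 : MemLp (v t) 2 (volume.restrict (ball (0 : EuclideanSpace ℝ (Fin 3)) (max R 1))) :=
    memLp_two_restrict_of_lintegral_lt_top hmt ((hCt 0).trans_lt ENNReal.coe_lt_top)
  have hvt1 : IntegrableOn (v t) (ball (0 : EuclideanSpace ℝ (Fin 3)) (max R 1)) volume := by
    haveI : IsFiniteMeasure (volume.restrict (ball (0 : EuclideanSpace ℝ (Fin 3)) (max R 1))) :=
      isFiniteMeasure_restrict.2 measure_ball_lt_top.ne
    exact (hvt2.mono_exponent one_le_two).integrable le_rfl
  have hft_int : Integrable ft volume := by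
    rw [← integrableOn_iff_integrable_of_support_subset
      (s := ball (0 : EuclideanSpace ℝ (Fin 3)) (max R 1))]
    · refine Integrable.mono' (hvt1.norm.mul_const Mg) (hmt.inner hgc.aestronglyMeasurable).restrict
        (ae_of_all _ fun x => ?_)
      calc ‖ft x‖ ≤ ‖v t x‖ * ‖g x‖ := norm_inner_le_norm _ _
        _ ≤ ‖v t x‖ * Mg := mul_le_mul_of_nonneg_left (hMg x) (norm_nonneg _)
    · intro x hx
      by_contra hxK
      exact hx (by rw [hft]; simp [hg0 x fun h' => hxK (hKR' h')])
  -- the difference, pointwise and integrated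
  have hpt : ∀ x, ‖f₀ x - ft x‖ₑ ≤
      c * K.indicator (fun x => ‖v t x - v₀ x‖ₑ ^ 2) x + c⁻¹ * ‖g x‖ₑ ^ 2 := by
    intro x
    have h1 : ‖f₀ x - ft x‖ₑ ≤ K.indicator (fun x => ‖v t x - v₀ x‖ₑ) x * ‖g x‖ₑ := by
      by_cases hx : x ∈ K
      · have e : f₀ x - ft x = ⟪v₀ x - v t x, g x⟫ := by
          rw [hf₀, hft]; simp only [inner_sub_left]
        rw [indicator_of_mem hx, e, Real.enorm_eq_ofReal_abs, ← enorm_sub_rev (v₀ x) (v t x),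
          ← ofReal_norm, ← ofReal_norm, ← ENNReal.ofReal_mul (norm_nonneg _)]
        exact ENNReal.ofReal_le_ofReal (abs_real_inner_le_norm _ _)
      · have : f₀ x - ft x = 0 := by rw [hf₀, hft]; simp [hg0 x hx]
        rw [this]
        simp
    refine h1.trans ((ENNReal.mul_le_mul_sq_add_inv_mul_sq hc0 hctop).trans (le_of_eq ?_))
    by_cases hx : x ∈ K
    · rw [indicator_of_mem hx, indicator_of_mem hx]
    · rw [indicator_of_notMem hx, indicator_of_notMem hx]
      simp
  have hlin : ∫⁻ x, ‖f₀ x - ft x‖ₑ ≤ ENNReal.ofReal (δ / 2) + ENNReal.ofReal (δ / 2) := by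
    have hmeas2 : AEMeasurable (fun x => c⁻¹ * ‖g x‖ₑ ^ 2) volume :=
      ((hgc.aestronglyMeasurable.aemeasurable.enorm.pow_const 2).const_mul _)
    calc ∫⁻ x, ‖f₀ x - ft x‖ₑ
        ≤ ∫⁻ x, (c * K.indicator (fun x => ‖v t x - v₀ x‖ₑ ^ 2) x + c⁻¹ * ‖g x‖ₑ ^ 2) :=
          lintegral_mono hpt
      _ = (c * ∫⁻ x in K, ‖v t x - v₀ x‖ₑ ^ 2) + c⁻¹ * N := by
          rw [lintegral_add_right' _ hmeas2, lintegral_const_mul' _ _ hctop,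
            lintegral_indicator hKm, lintegral_const_mul' _ _ (ENNReal.inv_ne_top.2 hc0), ← hN]
      _ ≤ c * (ENNReal.ofReal (δ / 2) / c) + ENNReal.ofReal (δ / 2) := by
          refine add_le_add ?_ hcN
          gcongr
      _ = ENNReal.ofReal (δ / 2) + ENNReal.ofReal (δ / 2) := by
          rw [ENNReal.mul_div_cancel hc0 hctop]
  -- conclusion
  have hsub : ∫ x, f₀ x = ∫ x, (f₀ x - ft x) := by
    rw [integral_sub hint hft_int, hdt, sub_zero]
  calc ‖∫ x, f₀ x‖ = ‖∫ x, (f₀ x - ft x)‖ := by rw [hsub]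
    _ ≤ ∫ x, ‖f₀ x - ft x‖ := norm_integral_le_integral_norm _
    _ = (∫⁻ x, ‖f₀ x - ft x‖ₑ).toReal := integral_norm_eq_lintegral_enorm (hint.1.sub hft_int.1)
    _ ≤ (ENNReal.ofReal (δ / 2) + ENNReal.ofReal (δ / 2)).toReal := by
        refine ENNReal.toReal_mono (by simp) hlin
    _ = δ := by
        rw [ENNReal.toReal_add ENNReal.ofReal_ne_top ENNReal.ofReal_ne_top,
          ENNReal.toReal_ofReal (by linarith)]
        ring

end Literature.Analysis.FluidPDE

end
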